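import Literature.AlgebraicGeometry.AbelianSchemes.MFKSubfunctorOfHilb
import Literature.AlgebraicGeometry.AbelianSchemes.AbelianSchemeDualTransportOfBaseChange
import Literature.AlgebraicGeometry.AbelianSchemes.AbelianSchemeOverHomNoetherianAnyBase
import Literature.AlgebraicGeometry.AbelianSchemes.AbelianSchemeOverFibreIdentity
import Literature.AlgebraicGeometry.AbelianSchemes.PolarizationLevelBaseQuotientDescent
import Literature.AlgebraicGeometry.AbelianSchemes.MumfordBundleClassifierBaseChange
import Literature.AlgebraicGeometry.AbelianSchemes.NormalisedBundleBaseChange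
import HarnessLib

/-!
# The MFK sub-functor of Hilb, INTRINSIC form: one clause on the raw square `Z₀ ×_{H₀} T → T`
# ([MumfordFogartyKirwan1994] Prop. 7.3, steps (I)–(VI); the (H-int) flattening of ★ `MFKSubfunctorOfHilb`)

Topic `AlgebraicGeometry/AbelianSchemes`; namespace `Literature.AlgebraicGeometry.AbelianSchemes.AbelianSchemeOver`; universe `0`.
Cell hodgecm-mathlib (D-0151), F-DAG leaf F-6, capstone FILE 3 (census `B-provers/B-p02/g14/CENSUS-F6-HInt-Flattening.B-p02g14.md`,
sockets `…/SOCKETS-F6-HInt-FILE3.B-p02g14.md`; B-p02 (g14) bytes, second hand B-p17 (g13), consumer = (H-rep) `represents` existence,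
B-p18 (g19)).  THEOREMS ONLY; books 0.  HC_CM is proved only modulo the 7 printed citations until rung 0 closes; this file discharges
none of them.

★ FILE 2 `exists_isImmersion_iff_mfkSubfunctor` states [MumfordFogartyKirwan1994] Prop. 7.3 on the raw projective family
`p₀ : Z₀ → H₀` NESTED at the abelian-scheme storey `H₂` (the clauses of steps (III)–(VI) are read on `A₂ ×_{H₂} T` for the
intermediate `v : T → H₂`).  The INTRINSIC clause `INT(b)` reads every clause on an ARBITRARY abelian scheme `A_b/T` sitting in a
cartesian square over `p₀` along `b : T → H₀` (unit and sections restricting `ε₀`, `τ₀ i`), with an ARBITRARY rigidified dual pair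
`D_b` and any `L_b ≅ L₀|_{A_b}` — the shape the (H-rep) representability argument produces.  This file (edition 1):
* §1 **`isBaseChangeVia_id_of_iso_of_one_comp`** (+ `_symm`) — two abelian-scheme structures on isomorphic `T`-schemes with the
  same unit are isomorphic AS GROUP SCHEMES ([MumfordFogartyKirwan1994] Cor. 6.4, any locally Noetherian base: ★
  `isMonHom_of_one_comp_of_isLocallyNoetherian_base`), in the tree's relation currency `IsBaseChangeVia (𝟙 T)`;
* §2 **`mfkIntrinsic_of_existsUnique_comp`** — a (unique) factorisation of `b` through the tower `H ↪ H₂ ↪ H₁ ↪ H₀` gives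
  `INT(b)`: the witnesses are the base changes along `v := w ≫ j` (`A_b := A₂ ×_{H₂} T` on the pasted square, `D_b := D₂ ×_{H₂} T`,
  the graph `Γ_ω` over `T` with `Γ_ω ≫ (A₂ ×_{H₂} T ×_T Â₂ ×_{H₂} T → A₂ ×_{H₂} Â₂) = Γ₁`); the classification letter of `[6] ≫ ω`
  base-changes by ★ `nonempty_pullbackP_baseChange_iso_pullback_mumfordBundle` and ★ `nonempty_pullback_normalised_iso_normalised_pullback`,
  the frame clause (VI) by ★ `isIso_pullback_map_comp_pushforwardBaseChangeHom_iff_of_isPullback_paste_horiz`.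
The converse (`INT(b)` ⟹ factorisation: transport of each clause along the rigidity isomorphism of §1 with ★ `hatTransport`, its
Poincaré clause, ★ `isLambdaOfAt_lamTransport`, ★ `LevelStructure.exists_comp_of_iso`, ★ `Polarization.hasType_of_isBaseChangeVia`, ★
`LevelStructure.isSymplecticLiftable_of_isBaseChangeVia`) and the head `existsUnique_comp_iff_mfkIntrinsic` are the sequel.

## References
* [MumfordFogartyKirwan1994] D. Mumford, J. Fogarty, F. Kirwan, *Geometric Invariant Theory*, 3rd ed. (1994), Ch. 6 §1
  Corollary 6.4 (p. 117), Ch. 7 §2 Definition 7.2 (p. 129), Proposition 7.3 and its proof (pp. 132–134).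
-/

noncomputable section

open CategoryTheory CategoryTheory.Limits AlgebraicGeometry MonoidalCategory Cardinal MonObj

namespace Literature.AlgebraicGeometry.AbelianSchemes

namespace AbelianSchemeOver

open Literature.AlgebraicGeometry.Motives Literature.AlgebraicGeometry.ModuliOfAbelianVarieties
  Literature.AlgebraicGeometry.Modules Literature.AlgebraicGeometry.AbelianVarieties Literature.AlgebraicGeometry.Morphisms
open scoped MonObj

/-! ### §1 Two group laws with the same unit on isomorphic `T`-schemes -/

section SameUnit

variable {T : Scheme.{0}} [IsLocallyNoetherian T] (A B : AbelianSchemeOver T)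

/-- **Two abelian schemes over a locally Noetherian `T` whose underlying `T`-schemes are isomorphic by a unit-preserving
isomorphism are isomorphic AS GROUP SCHEMES** ([MumfordFogartyKirwan1994] Cor. 6.4 over any locally Noetherian base, ★
`isMonHom_of_one_comp_of_isLocallyNoetherian_base`), in the tree's relation currency: `A` is the base change of `B` along
`𝟙 T` via `e` (★ `isBaseChangeVia_id_of_isMonHom`). [cite: MumfordFogartyKirwan1994, Ch. 6 §1 Corollary 6.2 and Corollary 6.4 (p. 117)]
[cite: MumfordFogartyKirwan1994, Ch. 7 §2 Definition 7.2 (p. 129)] -/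
theorem isBaseChangeVia_id_of_iso_of_one_comp (e : A.X ≅ B.X) (he : η[A.X] ≫ e.hom = η[B.X]) :
    A.IsBaseChangeVia B (𝟙 T) e.hom.left := by
  haveI := isMonHom_of_one_comp_of_isLocallyNoetherian_base e.hom he
  exact isBaseChangeVia_id_of_isMonHom A B e.hom

/-- The inverse direction: `B` is the base change of `A` along `𝟙 T` via `e⁻¹`. [cite: MumfordFogartyKirwan1994, Ch. 6 §1 Corollary 6.2 and Corollary 6.4 (p. 117)] -/
theorem isBaseChangeVia_id_of_iso_of_one_comp_symm (e : A.X ≅ B.X) (he : η[A.X] ≫ e.hom = η[B.X]) :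
    B.IsBaseChangeVia A (𝟙 T) e.inv.left := by
  refine isBaseChangeVia_id_of_iso_of_one_comp B A e.symm ?_
  rw [Iso.symm_hom, ← he, Category.assoc, e.hom_inv_id, Category.comp_id]

end SameUnit

/-- Tensor powers of isomorphic modules are isomorphic. [folklore] -/
private theorem nonempty_tensorPow_iso_of_iso {X : Scheme.{0}} {M M' : X.Modules} (e : M ≅ M') :
    ∀ n : ℕ, Nonempty (tensorPow M n ≅ tensorPow M' n)
  | 0 => ⟨Iso.refl _⟩
  | n + 1 => (nonempty_tensorPow_iso_of_iso e n).map fun i => tensorMapIso i e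

/-! ### §2 From a factorisation through the tower to the INTRINSIC clause on `Z₀ ×_{H₀} T` -/

section Intrinsic

variable {H₀ Z₀ : Scheme.{0}} (p₀ : Z₀ ⟶ H₀) (ε₀ : H₀ ⟶ Z₀) {g N : ℕ} (τ₀ : Fin g ⊕ Fin g → (H₀ ⟶ Z₀))
  (L₀ : Z₀.Modules) (δ : Fin g → ℕ)
  (u₀ : freeModule H₀ (Fin (6 ^ g * polarizationDegree δ)) ⟶ (Scheme.Modules.pushforward p₀).obj L₀)
  {H₁ H₂ H : Scheme.{0}} (j₁ : H₁ ⟶ H₀) (j₂ : H₂ ⟶ H₁) (j : H ⟶ H₂)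
  (A₂ : AbelianSchemeOver H₂) (pr₂ : A₂.X.left ⟶ Z₀) (sq₂ : IsPullback pr₂ A₂.X.hom p₀ (j₂ ≫ j₁))
  (hg₂ : A₂.IsOfRelDim g) (hunit₂ : A₂.unitSection ≫ pr₂ = (j₂ ≫ j₁) ≫ ε₀)
  (σ₂ : Fin g ⊕ Fin g → A₂.Sections) (hσ₂ : ∀ i, (σ₂ i).left ≫ pr₂ = (j₂ ≫ j₁) ≫ τ₀ i)
  (D₂ : A₂.DualPair)
  (hD₂ : Nonempty ((Scheme.Modules.pullback (DualPair.unitHatSlice D₂)).obj D₂.P ≅ SheafOfModules.unit _))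
  (hL₀ : HasRank L₀ 1)
  (eF : (Scheme.Modules.pullback (j₂ ≫ j₁)).obj (freeModule H₀ (Fin (6 ^ g * polarizationDegree δ))) ≅
    freeModule H₂ (Fin (6 ^ g * polarizationDegree δ)))
  (lam : A₂.X ⟶ D₂.hat.X)
  (hlam : ∀ ⦃U : Over H₂⦄ (a : U ⟶ A₂.X),
    Nonempty ((Scheme.Modules.pullback (A₂.X ◁ (a ≫ lam)).left).obj D₂.P ≅
      (Scheme.Modules.pullback (A₂.X ◁ a).left).obj (A₂.mumfordBundle
        (tensorObj ((Scheme.Modules.pullback pr₂).obj L₀) ((Scheme.Modules.pullback A₂.X.hom).obj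
          (Modules.dual ((Scheme.Modules.pullback A₂.unitSection).obj
            ((Scheme.Modules.pullback pr₂).obj L₀))))))))

include sq₂ hg₂ hunit₂ hσ₂ hD₂ hL₀ hlam in
set_option backward.isDefEq.respectTransparency false in
/-- **FROM THE TOWER TO THE INTRINSIC CLAUSE.**  In the setting exported by ★ FILE 2 `exists_isImmersion_iff_mfkSubfunctor`
(the (I)-locus `j₁`, the abelian scheme `A₂ → H₂` with its cartesian square `sq₂` onto `p₀`, unit / sections / dual pair /
classifying homomorphism, and the immersion `j : H ⟶ H₂` of ★ FILE 1 with its universal property `h`), every `b : T ⟶ H₀` that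
factors through `j ≫ j₂ ≫ j₁` satisfies the INTRINSIC clause `INT(b)` read on the raw square `Z₀ ×_{H₀} T → T`: its fibres
are smooth and geometrically connected, and `Z₀ ×_{H₀} T` carries an abelian-scheme structure `A_b` (square form `(A_b, pr_b, sq_b)`)
with unit `ε₀`, sections `τ₀`, a dual pair, a rank-one `L_b ≅ pr_b^*L₀`, and the five clauses of [MumfordFogartyKirwan1994]
Prop. 7.3 (V)/(P)/(III)(IV)(V′)/(VI) read over `T` itself.  All witnesses are BASE CHANGES along `v : T → H₂`
(`A_b := A₂ ×_{H₂} T`, …); the classification letter base-changes by ★ `nonempty_pullbackP_baseChange_iso_pullback_mumfordBundle`,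
the frame clause by ★ `isIso_pullback_map_comp_pushforwardBaseChangeHom_iff_of_isPullback_paste_horiz`.
[cite: MumfordFogartyKirwan1994, Ch. 7 §2 Proposition 7.3 (pp. 132–134)] [cite: MumfordFogartyKirwan1994, Ch. 7 §2 Definition 7.2 (p. 129)] -/
theorem mfkIntrinsic_of_existsUnique_comp [Mono j₁] [Mono j₂] [Mono j]
    (h₁ : ∀ {T XT : Scheme.{0}} (b : T ⟶ H₀) {pr : XT ⟶ Z₀} {pT : XT ⟶ T} (_ : IsPullback pr pT p₀ b),
      (∃! v₁ : T ⟶ H₁, v₁ ≫ j₁ = b) ↔ Smooth pT ∧ GeometricallyConnected pT)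
    (h : ∀ ⦃T : Scheme.{0}⦄ [IsLocallyNoetherian T] (v : T ⟶ H₂),
      (∃! w : T ⟶ H, w ≫ j = v) ↔
        ∃ (ω : (A₂.baseChange v).X ⟶ (D₂.hat.baseChange v).X)
          (Γ₁ : (A₂.baseChange v).left ⟶ A₂.prodLeft D₂.hat),
          IsMonHom ω ∧ ((𝟙 (A₂.baseChange v).X) ^ 6) ≫ ω = (Over.pullback v).map lam ∧
            Γ₁ ≫ pullback.fst A₂.X.hom D₂.hat.X.hom = pullback.fst A₂.X.hom v ∧
            Γ₁ ≫ pullback.snd A₂.X.hom D₂.hat.X.hom = ω.left ≫ pullback.fst D₂.hat.X.hom v ∧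
            Nonempty ((Scheme.Modules.pullback (pullback.fst A₂.X.hom v)).obj
                (tensorObj ((Scheme.Modules.pullback pr₂).obj L₀) ((Scheme.Modules.pullback A₂.X.hom).obj
                  (Modules.dual ((Scheme.Modules.pullback A₂.unitSection).obj
                    ((Scheme.Modules.pullback pr₂).obj L₀))))) ≅
              tensorPow ((Scheme.Modules.pullback Γ₁).obj D₂.P) 3) ∧
            ∃ pol : (A₂.baseChange v).Polarization (D₂.baseChange v), pol.lam = ω ∧ pol.HasType δ ∧
              (∃ φ : LevelStructure g N (A₂.baseChange v),
                (∀ i, φ.σ i = A₂.sectionBaseChange v (σ₂ i)) ∧ φ.IsSymplecticLiftable pol δ) ∧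
              IsIso ((Scheme.Modules.pullback v).map
                  (eF.inv ≫ (Scheme.Modules.pullback (j₂ ≫ j₁)).map u₀ ≫ pushforwardBaseChangeHom sq₂.w L₀) ≫
                pushforwardBaseChangeHom (IsPullback.of_hasPullback A₂.X.hom v).w
                  ((Scheme.Modules.pullback pr₂).obj L₀)))
    {T : Scheme.{0}} [IsLocallyNoetherian T] (b : T ⟶ H₀) (hw : ∃! w : T ⟶ H, w ≫ j ≫ j₂ ≫ j₁ = b) :
    Smooth (pullback.snd p₀ b) ∧ GeometricallyConnected (pullback.snd p₀ b) ∧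
      ∃ (Ab : AbelianSchemeOver T) (prb : Ab.X.left ⟶ Z₀) (sqb : IsPullback prb Ab.X.hom p₀ b)
        (_ : Ab.IsOfRelDim g) (_ : Ab.unitSection ≫ prb = b ≫ ε₀)
        (σb : Fin g ⊕ Fin g → Ab.Sections) (_ : ∀ i, (σb i).left ≫ prb = b ≫ τ₀ i)
        (Db : Ab.DualPair)
        (_ : Nonempty ((Scheme.Modules.pullback (DualPair.unitHatSlice Db)).obj Db.P ≅ SheafOfModules.unit _))
        (Lb : Ab.left.Modules) (_ : Nonempty (Lb ≅ (Scheme.Modules.pullback prb).obj L₀))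
        (ω : Ab.X ⟶ Db.hat.X) (Γ₁ : Ab.left ⟶ Ab.prodLeft Db.hat),
        IsMonHom ω ∧
          (∀ ⦃U : Over T⦄ (a : U ⟶ Ab.X),
            Nonempty ((Scheme.Modules.pullback (Ab.X ◁ (a ≫ ((𝟙 Ab.X) ^ 6) ≫ ω)).left).obj Db.P ≅
              (Scheme.Modules.pullback (Ab.X ◁ a).left).obj (Ab.mumfordBundle
                (tensorObj Lb ((Scheme.Modules.pullback Ab.X.hom).obj
                  (Modules.dual ((Scheme.Modules.pullback Ab.unitSection).obj Lb))))))) ∧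
          Γ₁ ≫ pullback.fst Ab.X.hom Db.hat.X.hom = 𝟙 _ ∧
          Γ₁ ≫ pullback.snd Ab.X.hom Db.hat.X.hom = ω.left ∧
          Nonempty (tensorObj Lb ((Scheme.Modules.pullback Ab.X.hom).obj
              (Modules.dual ((Scheme.Modules.pullback Ab.unitSection).obj Lb))) ≅
            tensorPow ((Scheme.Modules.pullback Γ₁).obj Db.P) 3) ∧
          ∃ pol : Ab.Polarization Db, pol.lam = ω ∧ pol.HasType δ ∧
            (∃ φ : LevelStructure g N Ab, (∀ i, φ.σ i = σb i) ∧ φ.IsSymplecticLiftable pol δ) ∧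
            IsIso ((Scheme.Modules.pullback b).map u₀ ≫ pushforwardBaseChangeHom sqb.w L₀) := by
  obtain ⟨w, hwb, -⟩ := hw
  obtain rfl : (w ≫ j) ≫ j₂ ≫ j₁ = b := by rw [Category.assoc]; exact hwb
  -- (I) on the canonical square of `p₀` along `b = (w ≫ j) ≫ j₂ ≫ j₁`
  have hI := (h₁ ((w ≫ j) ≫ j₂ ≫ j₁) (IsPullback.of_hasPullback p₀ ((w ≫ j) ≫ j₂ ≫ j₁))).1
    ⟨w ≫ j ≫ j₂, by simp only [Category.assoc],
      fun v hv => (cancel_mono j₁).1 (by simpa only [Category.assoc] using hv)⟩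
  refine ⟨hI.1, hI.2, ?_⟩
  -- the FILE 1 clauses over `v := w ≫ j`
  obtain ⟨ω, Γ₁, hωm, hω, hΓ₁₁, hΓ₁₂, ⟨e⟩, pol, hpol, hT, ⟨φ, hφ, hL⟩, hVI⟩ :=
    (h (w ≫ j)).1 ⟨w, rfl, fun w' hw' => (cancel_mono j).1 hw'⟩
  haveI := hωm
  -- the two squares
  have sqv : IsPullback (pullback.fst A₂.X.hom (w ≫ j)) (pullback.snd A₂.X.hom (w ≫ j)) A₂.X.hom (w ≫ j) :=
    IsPullback.of_hasPullback _ _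
  have sqb : IsPullback (pullback.fst A₂.X.hom (w ≫ j) ≫ pr₂) (A₂.baseChange (w ≫ j)).X.hom p₀
      ((w ≫ j) ≫ j₂ ≫ j₁) := sqv.paste_horiz sq₂
  -- the graph of `ω` over `T` itself and its comparison with `Γ₁`
  let Γb : (A₂.baseChange (w ≫ j)).left ⟶ (A₂.baseChange (w ≫ j)).prodLeft (D₂.hatBaseChange (w ≫ j)) :=
    pullback.lift (𝟙 _) ω.left (by rw [Category.id_comp]; exact (Over.w ω).symm)
  have hΓb₁ : Γb ≫ pullback.fst _ _ = 𝟙 _ := pullback.lift_fst _ _ _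
  have hΓb₂ : Γb ≫ pullback.snd _ _ = ω.left := pullback.lift_snd _ _ _
  have hΓb : Γb ≫ D₂.prodBaseChangeToProd (w ≫ j) = Γ₁ := by
    apply pullback.hom_ext
    · rw [Category.assoc, DualPair.prodBaseChangeToProd_fst, reassoc_of% hΓb₁, hΓ₁₁]
    · rw [Category.assoc, DualPair.prodBaseChangeToProd_snd, reassoc_of% hΓb₂, hΓ₁₂]
  -- `Γb^* 𝒫_T ≅ Γ₁^* 𝒫`
  have eP : (Scheme.Modules.pullback Γb).obj (D₂.PBaseChange (w ≫ j)) ≅ (Scheme.Modules.pullback Γ₁).obj D₂.P :=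
    (Scheme.Modules.pullbackComp Γb (D₂.prodBaseChangeToProd (w ≫ j))).app D₂.P ≪≫
      (Scheme.Modules.pullbackCongr hΓb).app D₂.P
  obtain ⟨e3⟩ := nonempty_tensorPow_iso_of_iso eP 3
  -- ranks
  have hM : HasRank ((Scheme.Modules.pullback pr₂).obj L₀) 1 := hasRank_pullback pr₂ hL₀
  have hM' : HasRank ((Scheme.Modules.pullback (X := (A₂.baseChange (w ≫ j)).left) (pullback.fst A₂.X.hom (w ≫ j))).obj
      ((Scheme.Modules.pullback pr₂).obj L₀)) 1 := hasRank_pullback _ hM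
  -- normalisation commutes with the base change `T → H₂` (★ B-p17 `NormalisedBundleBaseChange`)
  obtain ⟨enorm'⟩ := A₂.nonempty_pullback_normalised_iso_normalised_pullback (w ≫ j) hM
  have enorm := enorm'.symm
  -- `Λ` of isomorphic rank-one modules
  obtain ⟨mb⟩ := (A₂.baseChange (w ≫ j)).nonempty_mumfordBundle_iso_of_nonempty_iso
    (hasRank_pullback _ (A₂.hasRank_normalised _ hM)) ((A₂.baseChange (w ≫ j)).hasRank_normalised _ hM') ⟨enorm.symm⟩
  refine ⟨A₂.baseChange (w ≫ j), pullback.fst A₂.X.hom (w ≫ j) ≫ pr₂, sqb,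
    hg₂.baseChange _, ?_, fun i => A₂.sectionBaseChange (w ≫ j) (σ₂ i), ?_, D₂.baseChange (w ≫ j),
    D₂.nonempty_unitHatSlice_baseChange_iso hD₂,
    (Scheme.Modules.pullback (pullback.fst A₂.X.hom (w ≫ j))).obj ((Scheme.Modules.pullback pr₂).obj L₀),
    ⟨(Scheme.Modules.pullbackComp (pullback.fst A₂.X.hom (w ≫ j)) pr₂).app L₀⟩, ω, Γb, hωm, ?_,
    hΓb₁, hΓb₂, ⟨enorm ≪≫ e ≪≫ e3.symm⟩, pol, hpol, hT, ⟨φ, hφ, hL⟩, ?_⟩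
  · -- unit
    rw [← Category.assoc, unitSection_baseChange_comp_fst]
    exact (Category.assoc _ _ _).trans ((whisker_eq (w ≫ j) hunit₂).trans (Category.assoc _ _ _).symm)
  · -- sections
    intro i
    rw [← Category.assoc, sectionBaseChange_left_comp_fst]
    exact (Category.assoc _ _ _).trans ((whisker_eq (w ≫ j) (hσ₂ i)).trans (Category.assoc _ _ _).symm)
  · -- the classification letter of `[6] ≫ ω = Λ(L′)_T`, base-changed
    intro U a
    rw [hω]
    have h1 := A₂.nonempty_pullbackP_baseChange_iso_pullback_mumfordBundle (w ≫ j) D₂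
      (A₂.hasRank_normalised _ hM) lam
      (fun U' a' => by rw [DualPair.pullbackP_eq_pullback_whiskerLeft]; exact hlam a') a
    rw [DualPair.pullbackP_eq_pullback_whiskerLeft] at h1
    exact h1.map fun i => i ≪≫ (Scheme.Modules.pullback _).mapIso mb
  · -- (VI): the frame clause on the pasted square
    rw [Functor.map_comp, Category.assoc ((Scheme.Modules.pullback (w ≫ j)).map eF.inv), isIso_comp_left_iff,
      isIso_pullback_map_comp_pushforwardBaseChangeHom_iff_of_isPullback_paste_horiz sq₂
        (IsPullback.of_hasPullback A₂.X.hom (w ≫ j)) L₀ u₀] at hVI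
    exact hVI

end Intrinsic

end AbelianSchemeOver

end Literature.AlgebraicGeometry.AbelianSchemes

end
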